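import Summits.Ventures.LatticeQCDFlow.Scaling.TaggedCostSideDeep
import Summits.Ventures.LatticeQCDFlow.Scaling.StarOccupationComparison
import Summits.Ventures.LatticeQCDFlow.Scaling.TaggedDomination

/-!
HONEST FRAMING: exact (Metropolis-corrected) sampling algorithms for lattice gauge theory; figures
of merit are autocorrelation/cost numbers at stated couplings and volumes; no continuum-physics
claim.

# TaggedPerAttemptCertificateDeep — CONJECTURE W′ (THE `σ`-WEIGHTED PER-ATTEMPT CERTIFICATE) FOR A DEPTH-ADJACENT PAIR IN THE DEEP CONFIGURATION, `K ≥ 3`: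
# `L·(x̃(★) + (x̃(a) − ỹ(a)) − D_J) ≥ cost(x̃) + cost(ỹ)` FOR EVERY TRUNCATION `J` OF THE DISCOUNTED START-CONTENT DEFICIT `D_J = Σ_{n<J}(1−σ)σⁿ(y_{n+1}(z) − x_{n+1}(z))⁺`
# (lean-2 GEN-41, ours)

Venture-side (OURS).  Cell `lqcd-flow` (pub-lqcd), unit `pub-lqcd-lean-2-g41`, 2026-08-30.  Chapter AA (route (β), the cost side), file 8 = the assembly for one configuration.  MEMO-gen40 §4:
with the per-`j` gain `G_j = x_j(★) + (x_j(a)−y_j(a)) − 𝟙{z∉{a,b}}(y_j(z)−x_j(z))⁺` (Z8) the `σ`-weighted certificate `Σ_j w_j[L·G_j − cost(x_j) − cost(y_j)]` that the clock-conditioned step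
law (C1–C4) consumes equals `L·(x̃(★) + g̃ap_a − D) − cost(x̃) − cost(ỹ)` for the tail resolvents `x̃, ỹ`; W16 proved it WITHOUT `D` (Conjecture W).  Here, for the tagged chains of
W14∕W26 from an ordinary hub `z` with `W_z ≤ W_b ≤ W_a`, `W_z < W_a` (the tie `W_b = W_z` included), no present content strictly between `W_b` and `W_a`, three particles at or above `z` (`N_C(z) ≥ 2` or a content strictly above
`z`) and `K ≥ 3` (no presence proviso: absent contents — e.g. `a`, `b` themselves — are allowed):

* **`tagged_perAttempt_certificate_deep`**: `cost(x̃) + cost(ỹ) ≤ L·(x̃(★) + (x̃(a) − ỹ(a)) − D_J)` for every `J`, `L = 2K + M_X + M_Y` — by file 4's decomposition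
  (`= s3 + 2s1 + L·gap_a + gaps^θ − (1−θ_z)(ỹ(z)−x̃(z)) − L·D_J`), W21 `S2_of_star_domination` (`s3 ≥ 0`, from W26 `tagged_star_domination`), W26 `tagged_hub_domination` (the gaps, at
  `z` included), and file 7 (`L·D_J ≤ 2s1`).

Since `D_J ≥ Σ_j w_j·𝟙{z∉{a,b}}(…)⁺` truncated, this is the per-attempt-count criterion of route (β) on such an edge, uniformly in `J`.  Not covered (memo MEMO-gen41 §4): `K = 2`, exact ties,
the residual pair, hubs above `W_a`.  Literature grade (cell rule): OWN; nothing cited; no new bib keys.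
-/

open Finset

namespace Summit.Ventures.LatticeQCDFlow.Scaling

section PerAttemptDeep
variable {S : Type*} [Fintype S] [DecidableEq S]
variable {W θ : S → ℝ} {acc : S → S → ℝ} {p σ : ℝ} {K : ℕ} {NC : S → ℕ} {a b : S} {PX PY : Option S → Option S → ℝ}

/-- **CONJECTURE W′ ON A DEPTH-ADJACENT EDGE, DEEP CONFIGURATION, `K ≥ 3`** (see the module docstring). [ours] -/
theorem tagged_perAttempt_certificate_deep (hW : ∀ v, 0 < W v) (hp0 : 0 ≤ p) (hp : ∀ v, p * W v ≤ 1) (hθ : ∀ v, θ v = 1 / (1 + p * W v))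
    (hacc : ∀ h v, acc h v = min 1 (W h / W v)) (hK : 3 ≤ K) (hNC : ∑ v, NC v = K) (hab : W b ≤ W a)
    (hnone : ∀ w, NC w ≠ 0 → ¬ (W b < W w ∧ W w < W a))
    (hPXoff : ∀ h v, h ≠ v → PX (some h) (some v) = if NC h = 0 then 0 else (NC v : ℝ) / K * acc h v)
    (hPXin : ∀ h, PX (some h) none = if NC h = 0 then 0 else acc h a / K)
    (hPXdiag : ∀ h, PX (some h) (some h) = 1 - (∑ v ∈ univ.erase h, PX (some h) (some v) + PX (some h) none))
    (hPXout : ∀ v, PX none (some v) = (NC v : ℝ) / K * acc a v) (hPXstay : PX none none = 1 - ∑ v, PX none (some v))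
    (hPYoff : ∀ h v, h ≠ v → PY (some h) (some v) = if NC h = 0 then 0 else (NC v : ℝ) / K * acc h v)
    (hPYin : ∀ h, PY (some h) none = if NC h = 0 then 0 else acc h b / K)
    (hPYdiag : ∀ h, PY (some h) (some h) = 1 - (∑ v ∈ univ.erase h, PY (some h) (some v) + PY (some h) none))
    (hPYout : ∀ v, PY none (some v) = (NC v : ℝ) / K * acc b v) (hPYstay : PY none none = 1 - ∑ v, PY none (some v))
    {z : S} (hz : NC z ≠ 0) (hzb : W z ≤ W b) (hza : W z < W a) (hthree : 2 ≤ NC z ∨ ∃ w, NC w ≠ 0 ∧ W z < W w)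
    {x y : ℕ → Option S → ℝ}
    (hx0 : ∀ v, x 0 v = if v = some z then 1 else 0) (hxs : ∀ n v, x (n + 1) v = ∑ h, x n h * PX h v)
    (hy0 : ∀ v, y 0 v = if v = some z then 1 else 0) (hys : ∀ n v, y (n + 1) v = ∑ h, y n h * PY h v)
    {M : ℝ} (hM : M = ∑ v, θ v * (NC v : ℝ) + θ a) {L : ℝ} (hL : L = 2 * K + M + (∑ v, θ v * (NC v : ℝ) + θ b))
    (hσ0 : 0 ≤ σ) (hσ1 : σ < 1) {xt yt xs ys : Option S → ℝ}
    (hxt : ∀ t, xt t = (1 - σ) * PX (some z) t + σ * ∑ t', xt t' * PX t' t) (hyt : ∀ t, yt t = (1 - σ) * PY (some z) t + σ * ∑ t', yt t' * PY t' t)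
    (hxsr : ∀ t, xs t = (1 - σ) * PX none t + σ * ∑ t', xs t' * PX t' t) (hysr : ∀ t, ys t = (1 - σ) * PY none t + σ * ∑ t', ys t' * PY t' t) (J : ℕ) :
    (∑ v, xt (some v) * (1 - θ v) + xt none * (1 - θ a)) + (∑ v, yt (some v) * (1 - θ v) + yt none * (1 - θ b))
      ≤ L * (xt none + (xt (some a) - yt (some a)) - ∑ n ∈ range J, (1 - σ) * σ ^ n * max 0 (y (n + 1) (some z) - x (n + 1) (some z))) := by
  have hK1 : 1 ≤ K := by omega
  have hθm := theta_mem hW hp0 hp hθ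
  -- the exact decomposition (file 4)
  have hMY : (∑ v, θ v * (NC v : ℝ) + θ b) = M + (θ b - θ a) := by rw [hM]; ring
  have hdec := ledger_perStep_eq (θ := θ) (x := xt) (y := yt) (z := z) (a := a)
    (pen := ∑ n ∈ range J, (1 - σ) * σ ^ n * max 0 (y (n + 1) (some z) - x (n + 1) (some z))) hMY hL
  -- the incomes
  -- (i) `s3 ≥ 0`
  have hDstar := tagged_star_domination hW hacc hK1 hNC hab hPXoff hPXin hPXdiag hPXout hPXstay hPYoff hPYin hPYdiag hPYout hPYstay hσ0 hσ1 hxsr hysr z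
  have hs3 := S2_of_star_domination hW hp0 hp hθ hacc hK1 hNC hab hPXoff hPXin hPXdiag hPXout hPXstay hPYoff hPYin hPYout hσ0 hσ1 hz hxt hyt hxsr hysr hDstar
  -- (ii) domination from the hub at every ordinary content (W26), in particular at `a` and at `z`
  have hdom := tagged_hub_domination hW hacc hK1 hNC hab hPXoff hPXin hPXdiag hPXout hPXstay hPYoff hPYin hPYdiag hPYout hPYstay hσ0 hσ1 hz hxt hyt
  have hgap_a : 0 ≤ xt (some a) - yt (some a) := by linarith [hdom a]
  have hgaps : 0 ≤ ∑ v ∈ univ.erase z, (xt (some v) - yt (some v)) * (1 - θ v) :=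
    sum_nonneg fun v _ => mul_nonneg (by linarith [hdom v]) (by linarith [(hθm v).2])
  have hez : 0 ≤ -((1 - θ z) * (yt (some z) - xt (some z))) := by
    have h1 : 0 ≤ 1 - θ z := by linarith [(hθm z).2]
    have h2 : yt (some z) - xt (some z) ≤ 0 := by linarith [hdom z]
    nlinarith
  -- (iii) the cost side (file 7)
  have hcost := tagged_costSide_deep hW hp0 hp hθ hacc hK hNC hab hnone hPXoff hPXin hPXdiag hPXout hPXstay hPYoff hPYin hPYdiag hPYout hPYstay
    hz hzb hza hthree hx0 hxs hy0 hys hM hL hσ0 hσ1 hxt J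
  -- `L ≥ 0`
  have hMC0 : 0 ≤ ∑ v, θ v * (NC v : ℝ) := sum_nonneg fun v _ => mul_nonneg (by linarith [(hθm v).1]) (Nat.cast_nonneg _)
  have hL0 : 0 ≤ L := by
    have hK0 : (0 : ℝ) ≤ K := Nat.cast_nonneg _
    rw [hL, hM]; nlinarith [(hθm a).1, (hθm b).1]
  -- assemble
  have key : 0 ≤ L * (xt none + (xt (some a) - yt (some a)) - ∑ n ∈ range J, (1 - σ) * σ ^ n * max 0 (y (n + 1) (some z) - x (n + 1) (some z)))
      - (∑ v, xt (some v) * (1 - θ v) + xt none * (1 - θ a)) - (∑ v, yt (some v) * (1 - θ v) + yt none * (1 - θ b)) := by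
    rw [hdec]
    have hga : 0 ≤ L * (xt (some a) - yt (some a)) := mul_nonneg hL0 hgap_a
    nlinarith [hs3, hga, hgaps, hez, hcost]
  linarith

end PerAttemptDeep

end Summit.Ventures.LatticeQCDFlow.Scaling
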